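import Summits.NavierStokesRegularity.NavierStokesRegularity.Theorems.ScenarioCensusRowF1FrozenPairing
import Summits.NavierStokesRegularity.NavierStokesRegularity.Theorems.ScenarioCensusRowF1InviscidTop
import HarnessLib

/-!
# LINE «frozen-top» port, part 4/6: §4 THE KILL (b) — `slice_sub_const_of_pairing_eq`, `eq_zero_of_increments_const`, `eq_zero_of_weakEquilibrium`, `eq_zero_of_frozenVorticity`,
# `frozen_of_vorticitySteady`, `eq_zero_of_vorticitySteady`

Re-homed for the scenario census (typer seat ns-census-typer-1 g8; the cells F1fzq ⊇ F1fz are MEMBERS OF RECORD «DECIDED IN KERNEL IN FILES» of row F1 since census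
v1.72 (critic idea-crit-3 g7 PASS — no price 23:50:38Z; ref ns-census-ref g9 PRE-CHECK ✓ §14.21 item 32 (shim probe a49fdeaa); lead-presearch label); this port makes
them TREE-decided): VERBATIM PORT of ns-idea-3 LINE 20 «frozen-top», `pub/ideators/ns-idea-3/lines/frozen-top/line-frozen-top.lean` sha16 edc3c151346cc4e4 (1610 l.,
0 sorry; the critic's / ref's farm runs went through a shim because the line's import `Literature.Analysis.FunctionSpaces.WeakTimeDerivativeClassical` had no
farm build — in this port that import is carried only by the part that uses it, `…FrozenPairing` (`FunctionSpaces.sub_eq_intervalIntegral_of_forall_test` in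
`pairing_eq_of_weakEquilibrium`)), split for the 400-line rule into `ScenarioCensusRowF1Frozen` (§1–§2 with the `C²_loc`
tool) → `…FrozenThird` (`C³_loc`) → `…FrozenPairing` (§4a) → `…FrozenKill` (§4b) → `…FrozenTransfer` (§5–§6) → `…FrozenTop` (§7 + census KEYS).  Lean text VERBATIM in namespace `…Theorems.ScenarioCensus.FrozenTop` (the line's `…Cruxes.ScenarioCensusRowF1.FrozenTopLine`
re-homed); port edits: the WTDC import moved to the one part that needs it, `@[conjecture]` on the residual `FreezeSlack` (≡ `ScenarioCensus.Row_F1`, OPEN), five one-line docstrings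
added (gate lint).

No census VALUE is moved here (row F1 stays OPEN-WITH-LINE; the members become TREE-decided by name); NS regularity is NOT proved; `Row_F1` is untouched
(zero movement, `freezeSlack_iff_rowF1`); no summit statement is proved by this file. Lemmas that restate already-landed tree declarations are taken BY NAME (gate lint `dedup.landed`): `fderiv_smul_stPull_apply` = `InviscidTop.fderiv_smul_stPull_apply`, `fderiv_smul_stPull` = `InviscidTop.fderiv_smul_stPull`, `fderiv_fderiv_smul_stPull` = `InviscidTop.fderiv_fderiv_smul_stPull`, `fderiv_fderiv_zoom` = `InviscidTop.fderiv_fderiv_zoom`, `tendsto_clm_of_tendsto_apply` = `InviscidTop.tendsto_clm_of_tendsto_apply`, `tendsto_fderiv_fderiv_apply_of_bound` = `InviscidTop.tendsto_fderiv_fderiv_apply_of_bound`, `tendsto_fderiv_fderiv_of_bound` = `InviscidTop.tendsto_fderiv_fderiv_of_bound`, `tendsto_fderiv_fderiv_of_typeI_seq_Ioo` = `InviscidTop.tendsto_fderiv_fderiv_of_typeI_seq_Ioo`, `tendsto_fderiv_fderiv_of_isTypeIAncientMild_seq` = `InviscidTop.tendsto_fderiv_fderiv_of_isTypeIAncientMild_seq`,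 `sing_of_not_bounded` = `InviscidTop.sing_of_not_bounded`, `tendsto_physicalTime` = `ColumnarTop.tendsto_physicalTime`, `eventually_fast` = `ColumnarTop.eventually_fast`, `sqrt_timeLag` = `StretchedTop.sqrt_timeLag`, `forall_of_forall_ne_zero` = `StretchedTop.forall_of_forall_ne_zero`.
-/

-- the summit and its single problem share the name `NavierStokesRegularity` (D-0017 nested layout)
set_option linter.dupNamespace false

noncomputable section

open MeasureTheory Set Function Filter TopologicalSpace Metric
open scoped Topology NNReal ENNReal InnerProductSpace RealInnerProductSpace Laplacian

namespace Summit.NavierStokesRegularity.NavierStokesRegularity.Theorems.ScenarioCensus.FrozenTop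

open Literature.Analysis Literature.Analysis.FluidPDE
open Summit.NavierStokesRegularity.NavierStokesRegularity.Theorems

/-- **Step 2 (annihilated increments are constant).**  If two slices `u(t), u(s)` of a `𝒦`-field have the same
curl-type pairings, their difference is a constant vector (div–curl annihilator lemma ⇒ weakly harmonic
components ⇒ bounded harmonic ⇒ Liouville). -/
theorem slice_sub_const_of_pairing_eq {C : ℝ} {u : ℝ → E3 → E3} (hu : IsTypeIAncientMild C u)
    {s t : ℝ} (hs : s < 0) (ht : t < 0)
    (h : ∀ g : E3 → ℝ, FunctionSpaces.IsTestFunctionOn (⊤ : Opens E3) g → ∀ a c : E3,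
      ∫ x, ⟪u t x, cp g a c x⟫ = ∫ x, ⟪u s x, cp g a c x⟫) :
    ∀ x y : E3, u t x - u s x = u t y - u s y := by
  set V : E3 → E3 := fun x => u t x - u s x with hVdef
  have hVs : ContDiff ℝ 2 V := ((hu.contDiff_slice ht).sub (hu.contDiff_slice hs)).of_le (by norm_cast)
  have hV1 : ContDiff ℝ 1 V := hVs.of_le (by norm_num)
  have hVc : Continuous V := hVs.continuous
  have hVl : LocallyIntegrable V volume := hVc.locallyIntegrable
  have hVdiv : IsWeaklyDivFree V := by
    refine VectorCalculus.IsDivFree.isWeaklyDivFree_holds (fun x => ?_) hV1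
    rw [hVdef, show (fun x => u t x - u s x) = fun x => u t x - u s x from rfl,
      divergence_sub_apply ((hu.contDiff_slice ht).differentiable (by simp) x)
        ((hu.contDiff_slice hs).differentiable (by simp) x), hu.isDivFree ht x, hu.isDivFree hs x, sub_zero]
  have hperp : ∀ g : E3 → ℝ, FunctionSpaces.IsTestFunctionOn (⊤ : Opens E3) g → ∀ a c : E3,
      ∫ x, ⟪V x, fderiv ℝ g x a • c - fderiv ℝ g x c • a⟫ = 0 := by
    intro g hg a c
    have hΨ := cp_isTest hg a c
    have hI := fun (r : ℝ) (hr : r < 0) =>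
      integrable_inner_of_hasCompactSupport_right (hu.continuous_slice hr) hΨ.contDiff.continuous hΨ.hasCompactSupport
    have : ∫ x, ⟪V x, cp g a c x⟫ = 0 := by
      simp_rw [hVdef, inner_sub_left]
      rw [integral_sub (hI t ht) (hI s hs), h g hg a c, sub_self]
    simpa [cp] using this
  -- every component `x ↦ ⟪V x, e⟫` is harmonic and bounded, hence constant
  have hM : ∀ x, ‖V x‖ ≤ C / Real.sqrt (-t) + C / Real.sqrt (-s) := fun x =>
    (norm_sub_le _ _).trans (add_le_add (hu.norm_le ht x) (hu.norm_le hs x))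
  have hcomp : ∀ e : E3, ∀ x y : E3, ⟪V x, e⟫ = ⟪V y, e⟫ := by
    intro e x y
    set f : E3 → ℝ := fun z => ⟪V z, e⟫ with hfdef
    have hf2 : ContDiff ℝ 2 f := hVs.inner ℝ contDiff_const
    have hΔc : Continuous (Δ f) := continuous_laplacian hf2
    -- weakly harmonic
    have hweakΔ : ∀ θ : E3 → ℝ, ContDiff ℝ (⊤ : ℕ∞) θ → HasCompactSupport θ → ∫ z, θ z * (Δ f) z = 0 := by
      intro θ hθ hθc
      have hθt : FunctionSpaces.IsTestFunctionOn (⊤ : Opens E3) θ := ⟨hθ, hθc, by simp⟩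
      have h0 := integral_laplacian_mul_inner_eq_zero_of_curlPair hVl hVdiv hperp hθt e
      -- move the Laplacian: `∫ Δθ f = ∫ θ Δf`
      have hθ2 : ContDiff ℝ 2 θ := hθ.of_le (by norm_cast)
      have h1 := integral_inner_laplacian_comm (v := f) (w := θ) hf2 hθ2 hθc
      have h1' : ∫ z, θ z * (Δ f) z = ∫ z, (Δ θ) z * f z := by
        simpa only [RCLike.inner_apply, conj_trivial] using h1
      rw [h1']
      exact h0
    have hae : ∀ᵐ z ∂(volume : Measure E3), (Δ f) z = 0 :=
      ae_eq_zero_of_integral_contDiff_smul_eq_zero hΔc.locallyIntegrable fun θ hθ hθc => by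
        simpa only [smul_eq_mul] using hweakΔ θ hθ hθc
    have hΔ0 : ∀ z, (Δ f) z = 0 := by
      have : (Δ f) = fun _ => (0 : ℝ) := (Continuous.ae_eq_iff_eq volume hΔc continuous_const).1 hae
      exact fun z => congrFun this z
    have hharm := harmonicOnNhd_of_laplacian_eq_zero hf2 hΔ0
    have hbd : ∀ z, |f z| ≤ (C / Real.sqrt (-t) + C / Real.sqrt (-s)) * ‖e‖ := fun z => by
      rw [hfdef]
      calc |⟪V z, e⟫| ≤ ‖V z‖ * ‖e‖ := abs_real_inner_le_norm _ _
        _ ≤ (C / Real.sqrt (-t) + C / Real.sqrt (-s)) * ‖e‖ := mul_le_mul_of_nonneg_right (hM z) (norm_nonneg _)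
    exact hharm.apply_eq_apply_of_abs_le hbd x y
  intro x y
  have : ∀ e : E3, ⟪V x - V y, e⟫ = 0 := fun e => by rw [inner_sub_left, hcomp e x y, sub_self]
  have hzero : V x - V y = 0 := by
    have := this (V x - V y)
    exact inner_self_eq_zero.1 this
  exact sub_eq_zero.1 hzero

/-- **Step 3 (constant increments + Type-I decay ⇒ trivial).**  If all slice increments `u(t) − u(s)` are
spatially constant, the Type-I decay `‖u(s, ·)‖ ≤ C/√(−s) → 0` (`s → −∞`) makes every slice constant, and the
gauge lemma `eq_zero_of_slice_const` kills `u`. -/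
theorem eq_zero_of_increments_const {C : ℝ} {u : ℝ → E3 → E3} (hu : IsTypeIAncientMild C u)
    (h : ∀ s < (0 : ℝ), ∀ t < (0 : ℝ), ∀ x y : E3, u t x - u s x = u t y - u s y) :
    ∀ t < (0 : ℝ), ∀ x, u t x = 0 := by
  have hC : 0 ≤ C := hu.nonneg
  have hub : ∀ t < (0 : ℝ), ∀ x, u t x = u t 0 := by
    intro t ht x
    by_contra hne
    have hd : 0 < ‖u t x - u t 0‖ := norm_pos_iff.2 (sub_ne_zero.2 hne)
    set d : ℝ := ‖u t x - u t 0‖ with hddef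
    set r : ℝ := 2 * C / d + 1 with hrdef
    have hr : 0 < r := by positivity
    have hs : -(r ^ 2) < 0 := neg_neg_of_pos (pow_pos hr 2)
    have hinc := h (-(r ^ 2)) hs t ht x 0
    have e1 : u t x - u t 0 = u (-(r ^ 2)) x - u (-(r ^ 2)) 0 := sub_eq_sub_iff_sub_eq_sub.1 hinc
    have hle : d ≤ 2 * C / r := by
      rw [hddef, e1]
      calc ‖u (-(r ^ 2)) x - u (-(r ^ 2)) 0‖ ≤ ‖u (-(r ^ 2)) x‖ + ‖u (-(r ^ 2)) 0‖ := norm_sub_le _ _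
        _ ≤ C / Real.sqrt (-(-(r ^ 2))) + C / Real.sqrt (-(-(r ^ 2))) :=
          add_le_add (hu.norm_le hs x) (hu.norm_le hs 0)
        _ = 2 * C / r := by rw [neg_neg, Real.sqrt_sq hr.le]; ring
    have hlt : 2 * C / r < d := by
      rw [div_lt_iff₀ hr, hrdef]
      have : d * (2 * C / d + 1) = 2 * C + d := by field_simp
      rw [this]; linarith
    linarith
  intro t ht x
  exact hu.eq_zero_of_slice_const (b := fun t => u t 0) hub ht x

/-- **THE KILL (weak Eulerian equilibrium ⇒ trivial).**  A `𝒦_C` field each of whose slices is a steady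
unit-viscosity Navier–Stokes flow IN THE WEAK (curl-tested) SENSE — `Δ W(s) − (W(s)·∇) W(s) ⊥` every curl-type
test field, i.e. `= ∇q(s)` distributionally — is trivial.  Mechanism (new, time-direction rigidity): the weak
Navier–Stokes identity of `𝒦` (KNSS §4, after a time shift) makes the curl-type pairings of `W` constant in
time; increments are curl- and div-annihilated, hence harmonic and bounded, hence constant; the Type-I decay
`‖W(s)‖ ≤ C/√(−s) → 0` (`s → −∞`) makes every slice constant; the gauge lemma kills it. -/
theorem eq_zero_of_weakEquilibrium {C : ℝ} {W : ℝ → E3 → E3} (hW : IsTypeIAncientMild C W)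
    (hbal : ∀ s < (0 : ℝ), ∀ g : E3 → ℝ, FunctionSpaces.IsTestFunctionOn (⊤ : Opens E3) g → ∀ a c : E3,
      ∫ x, ⟪(Δ (W s)) x - convect (W s) (W s) x, cp g a c x⟫ = 0) :
    ∀ s < (0 : ℝ), ∀ y : E3, W s y = 0 := by
  intro s hs y
  set δ : ℝ := -s / 2 with hδdef
  have hδ : 0 < δ := by rw [hδdef]; linarith
  set u : ℝ → E3 → E3 := fun t => W (t - δ) with hudef
  have hu : IsTypeIAncientMild C u := hW.comp_sub_right hδ.le
  have hmeas : AEStronglyMeasurable (uncurry u) ((volume : Measure (ℝ × E3)).restrict (Iio 0 ×ˢ univ)) :=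
    hu.continuousOn_uncurry.aestronglyMeasurable (measurableSet_Iio.prod MeasurableSet.univ)
  have hweak : IsBoundedWeakNSSolutionOn (Iio (0 : ℝ)) isOpen_Iio 1 u :=
    (hW.isBoundedAncientMildSolution_sub hδ).isBoundedWeakNSSolutionOn one_pos hmeas
      fun t ht => hu.aestronglyMeasurable_slice ht
  have hbal' : ∀ τ < (0 : ℝ), ∀ g : E3 → ℝ, FunctionSpaces.IsTestFunctionOn (⊤ : Opens E3) g → ∀ a c : E3,
      ∫ x, ⟪(Δ (u τ)) x - convect (u τ) (u τ) x, cp g a c x⟫ = 0 :=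
    fun τ hτ g hg a c => hbal (τ - δ) (by linarith) g hg a c
  have hinc : ∀ σ < (0 : ℝ), ∀ τ < (0 : ℝ), ∀ x z : E3, u τ x - u σ x = u τ z - u σ z :=
    fun σ hσ τ hτ => slice_sub_const_of_pairing_eq hu hσ hτ fun g hg a c =>
      pairing_eq_of_weakEquilibrium hu hweak hbal' hg a c hσ hτ
  have h0 := eq_zero_of_increments_const hu hinc
  have e : W s y = u (s + δ) y := by simp only [hudef, add_sub_cancel_right]
  rw [e]
  exact h0 (s + δ) (by rw [hδdef]; linarith) y

/-- **FROZEN VORTICITY ⇒ TRIVIAL**: if the vorticity of `W ∈ 𝒦_C` does not depend on time, `W ≡ 0`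
(curl-type pairings are vorticity pairings: tree `integral_inner_curlPair_eq_integral_inner_curl_smul`). -/
theorem eq_zero_of_frozenVorticity {C : ℝ} {W : ℝ → E3 → E3} (hW : IsTypeIAncientMild C W)
    (h : ∀ s < (0 : ℝ), ∀ t < (0 : ℝ), ∀ y : E3, curl (W t) y = curl (W s) y) :
    ∀ s < (0 : ℝ), ∀ y : E3, W s y = 0 := by
  have hinc : ∀ σ < (0 : ℝ), ∀ τ < (0 : ℝ), ∀ x z : E3, W τ x - W σ x = W τ z - W σ z := by
    intro σ hσ τ hτ
    refine slice_sub_const_of_pairing_eq hW hσ hτ fun g hg a c => ?_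
    have hg1 : ContDiff ℝ 1 g := hg.contDiff.of_le (by norm_cast)
    have h1 : ∀ r < (0 : ℝ), ∫ x, ⟪W r x, cp g a c x⟫ = ∫ x, ⟪curl (W r) x, g x • cross c a⟫ := fun r hr =>
      integral_inner_curlPair_eq_integral_inner_curl_smul
        ((hW.contDiff_slice hr).of_le (by norm_cast)) hg1 hg.hasCompactSupport a c
    rw [h1 τ hτ, h1 σ hσ]
    exact integral_congr_ae (Eventually.of_forall fun x => by
      show ⟪curl (W τ) x, g x • cross c a⟫ = ⟪curl (W σ) x, g x • cross c a⟫
      rw [h σ hσ τ hτ x])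
  intro s hs y
  exact eq_zero_of_increments_const hW hinc s hs y

/-- **Vorticity-steady slices ⇒ frozen vorticity**: if every slice of `W ∈ 𝒦_C` satisfies the STEADY vorticity
equation `Δω − (W·∇)ω + (ω·∇)W = 0`, then `ω` does not depend on time (the vorticity equation of the classical
solution `W` on the windows `(t₀, 0)` gives `∂ₛω ≡ 0`). -/
theorem frozen_of_vorticitySteady {C : ℝ} {W : ℝ → E3 → E3} (hW : IsTypeIAncientMild C W)
    (h : ∀ s < (0 : ℝ), ∀ y : E3,
      (Δ (curl (W s))) y - convect (W s) (curl (W s)) y + convect (curl (W s)) (W s) y = 0) :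
    ∀ s < (0 : ℝ), ∀ t < (0 : ℝ), ∀ y : E3, curl (W t) y = curl (W s) y := by
  -- constancy of `σ ↦ curl (W σ) y` on every window `(t₀, 0)`
  have key : ∀ t₀ < (0 : ℝ), ∀ y : E3, ∀ a b : ℝ, a ∈ Ioo t₀ 0 → b ∈ Ioo t₀ 0 →
      curl (W a) y = curl (W b) y := by
    intro t₀ ht₀ y a b ha hb
    obtain ⟨q, hcl⟩ := hW.exists_isClassicalNSSolutionOn_Ioo ht₀
    have hS : UniqueDiffOn ℝ (Ioo t₀ 0) := uniqueDiffOn_Ioo t₀ 0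
    have hScl : Ioo t₀ 0 ⊆ closure (interior (Ioo t₀ 0)) := by
      rw [interior_Ioo]; exact subset_closure
    have hsm : IsSmoothSpaceTimeOn (Ioo t₀ 0) (vorticity W) :=
      hcl.smooth_velocity.isSmoothSpaceTimeOn_vorticity hS
    have hzero : ∀ σ ∈ Ioo t₀ 0, timeDerivWithin (Ioo t₀ 0) (vorticity W) σ y = 0 := by
      intro σ hσ
      have hv := hcl.vorticity_eq hS hScl (fun _ _ z => curl_zero z) hσ y
      rw [vorticity_apply, one_smul] at hv
      have h0 := h σ hσ.2 y
      have e : timeDerivWithin (Ioo t₀ 0) (vorticity W) σ y =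
          (Δ (curl (W σ))) y - convect (W σ) (curl (W σ)) y + convect (curl (W σ)) (W σ) y := by
        rw [eq_sub_iff_add_eq.2 hv.symm]
        abel
      rw [e, h0]
    have hder : ∀ σ ∈ Ioo t₀ 0, HasDerivWithinAt (fun s => vorticity W s y) (0 : E3) (Ioo t₀ 0) σ := by
      intro σ hσ
      have hd := hsm.hasDerivWithinAt_timeDerivWithin hS hσ y
      rwa [hzero σ hσ] at hd
    have hdiff : DifferentiableOn ℝ (fun s => vorticity W s y) (Ioo t₀ 0) := fun σ hσ =>
      (hder σ hσ).differentiableWithinAt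
    have hconst := (convex_Ioo t₀ 0).is_const_of_fderivWithin_eq_zero hdiff (fun σ hσ => by
      have h1 := (hder σ hσ).hasFDerivWithinAt
      have := h1.fderivWithin (hS σ hσ)
      rw [this]; ext; simp) ha hb
    simpa [vorticity_apply] using hconst
  intro s hs t ht y
  have ht₀ : min s t - 1 < 0 := by
    have := min_le_left s t; linarith
  exact key _ ht₀ y t s ⟨by have := min_le_right s t; linarith, ht⟩ ⟨by have := min_le_left s t; linarith, hs⟩

/-- **VORTICITY-STEADY TYPE-I ANCIENT MILD SOLUTIONS ARE TRIVIAL** (the kill): `W ∈ 𝒦_C` each of whose slices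
solves the steady vorticity equation `Δω − (W·∇)ω + (ω·∇)W = 0` is `≡ 0`. -/
theorem eq_zero_of_vorticitySteady {C : ℝ} {W : ℝ → E3 → E3} (hW : IsTypeIAncientMild C W)
    (h : ∀ s < (0 : ℝ), ∀ y : E3,
      (Δ (curl (W s))) y - convect (W s) (curl (W s)) y + convect (curl (W s)) (W s) y = 0) :
    ∀ s < (0 : ℝ), ∀ y : E3, W s y = 0 :=
  eq_zero_of_frozenVorticity hW (frozen_of_vorticitySteady hW h)

end Summit.NavierStokesRegularity.NavierStokesRegularity.Theorems.ScenarioCensus.FrozenTop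

end
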